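import Summits.QuantumFields.BalabanUV.T4Continuum.Support.VariationalCovariantLipschitz
import Summits.QuantumFields.BalabanUV.T4Continuum.Support.VariationalCovariantTower
import Summits.QuantumFields.BalabanUV.T4Continuum.Support.NestedContourTransportBound
import Literature.MathematicalPhysics.QuantumFieldTheory.Balaban1983to89.T4EtaRateMin

/-!
# T⁴ programme, spine node NE2 (U1a), lane P2 — SUPPLIER ITEM (O2) «L-NE3», THE TWO-RUNS ADAPTER, file 1 of 2:
# node U1b's `T4EtaRateMin.LocalRate` on a readings object for U(1) connection towers over the P2 tori ⟺ child-bond ∕ parent-bond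
# consistency of the normalised phases; and the one-level product estimate `n·‖Π_L R′ − (1 + w)‖ ≤ β + n·(Lb)²∕2·(1+b)^L`

NE2 formalisation swarm `b2b-balaban-t4-ne2-formalise-*`, leaf prover 09 (gen 4), supplier item (O2) of the P2 skeleton
`t4/skeletons/NE2-t4-ne2-p2.md` §7 («(O2) NE3 adapter for the two-runs face (aligned distance of (U_{k+1}(V) one-step data, Q̄-composite)
vs U_k(V) data ≤ C₃θ₃^k from `T4EtaRateMin.LocalRate` — S∕M, model level)»), on the road owner's ∕ suppliers' carriers: level-`k` torus
`Tor (fine (L^k) M)`, one-step-fine coordinates `Tor (fine L (fine (L^k) M))` (`B5Composition116.sites`), block points `B5Block118.bpt`, straight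
transporters `VariationalCovariantFederbush.piT` and the one-block transport mismatch `mis` (p210720), `VariationalCovariantLipschitz.aligned ∕
phaseRatio` (leaf s8, p212809), node U1b's `T4EtaRateMin.Readings ∕ LocalRate`, and leaf-06's `NestedContourTransportBound.one_add_pow_sub_linear_le`
(p210920) BY NAME.  File 2 (`VariationalCovariantTwoRunsNE3`) draws the tower corollary and the plug shapes.

THE POINT.  On road P2 the η-rate of the scalar covariant effective actions along Bałaban's ACTUAL runs `k ↦ Δ′_k(U_k(V))` is the canonical-pair
bracket (coarse datum at level `k`, fine datum at level `k+1`; `VariationalCovariantTowerLaw`, the owner's «P2-END») applied to the SPLICED tower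
`Rc k := R_k(V)`, `R′ k := R_{k+1}(V)` — and the only place where the two runs meet is the one-block transport mismatch `mis (R_k(V)) (R_{k+1}(V)) T′`
(equivalently leaf s8's aligned-connection number `ρ`).  Splitting off run B's own loop defect (`norm_mis_le`, any intermediate coarse connection
`R̄`), what remains is ONE number per coarse bond: the distance between the coarse phase `R_k(V)(y,μ)` and the STRAIGHT PRODUCT
`Π_{t<L} R_{k+1}(V)(Ly + t e_μ, μ)` of the next run's phases along that bond (`coarsen`).  These two files prove that this number is controlled by node
U1b's `LocalRate` — read, as in row B6 (`NE2FromNE3.bgReadings`), on the NORMALISED connection tower at block-addressed bonds (child bond versus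
parent bond = King's corresponding points).  This file:
 * §1 block addresses on the P2 tori: `pt x₀ r k : Tor (fine (L^k) M)` (`pt (k+1) = sites⁻¹ (bpt (pt k) (r k))`), `exists_pt`;
 * §2 **`towReadings 𝒟`** — the `T4EtaRateMin.Readings` of a class `𝒟` of towers `R : (k : ℕ) → Tor (fine (L^k) M) → Fin d → ℂ`: the local
   reading of `R` after `k` steps at the unit-scale address `s = (x₀, r, μ, re∕im)` is `Re∕Im (L^k·(R k (pt x₀ r k) μ − 1))`; the family form
   `famReadings Rt dom` (data `V : ι`, towers `Rt V`) and `localRate_famReadings_iff` (⇔ the class form on `Rt '' dom`);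
 * §3 **`consistent_of_localRate`** ∕ **`localRate_of_consistent`** (faithful both ways): `LocalRate (towReadings 𝒟) C θ` versus
   `‖L^{k+1}·(R (k+1) (sites⁻¹ (bpt y j)) μ − 1) − L^k·(R k y μ − 1)‖ ≤ 2Cθ^k` for every tower of the class, level, coarse site, offset, direction;
 * §4 ONE LEVEL, PURE ALGEBRA: `norm_piT_sub_one_le` (product telescoping) and **`norm_piT_sub_le`**
   (`n·‖Π_L R′ − (1 + w)‖ ≤ β + n·(Lb)²∕2·(1+b)^L` from per-bond size `‖R′ − 1‖ ≤ b` and normalised consistency `‖nL·(R′ − 1) − n·w‖ ≤ β`);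
   `norm_mis_le` (splitting the mismatch at an intermediate coarse connection), `aligned_phaseRatio_self` (equal unit-modulus site transports),
   `bpt_zero_add_tstep`, and the straight-product coarsening `coarsen R′ (y,μ) := Π_L R′` from the block base point.
WHAT IS NOT HERE (stated, not hidden): any discharge of `LocalRate` (node NE3 ∕ U1b is OPEN — the hypothesis is DISPLAYED); any identification of the
class `𝒟` with the (3.35)-gauge phases of Bałaban's minimisers `U_k(V)` (reading NOT asserted; no B0, trigger c5); run B's OWN loop part of the mismatch
(the CLASS geometric leaf (O3), `VariationalTaxiTransport`); the END (owner).

HONEST FRAMING (T4-DAG p. 1).  Model level (U(1) charged-scalar sector of road P2; towers and site transports DATA); bookkeeping + one elementary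
product estimate; nothing printed is a hypothesis (every `[cite:]` is a SHAPE locator); no `def … : Prop` fact; no `sorry`; axioms standard.  NE3 OPEN;
NE2 NOT proved; spine PROVED 0∕9 unchanged; rung (B)+1 finite T⁴ — NOT infinite volume, NOT a mass gap, NOT Clay.  HONEST DEPENDENCY (cell, verbatim):
continuum YM on T⁴ ⇐ BetaPertH ∧ nine spine estimates (0/9 proved); BetaPertH ⇐ (D1) ∧ (D4) ∧ CAP+tail; G-an2-4 gates asym, D1 and NE2/3/4.
-/

noncomputable section

open scoped BigOperators ComplexConjugate

namespace Summit.QuantumFields.BalabanUV.T4Continuum.VariationalCovariantTwoRuns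

open Finset
open Literature.MathematicalPhysics.QuantumFieldTheory.Balaban1983to89
open Literature.MathematicalPhysics.QuantumFieldTheory.Balaban1983to89.B5Prop11Plancherel (Tor fine unitVec)
open Literature.MathematicalPhysics.QuantumFieldTheory.Balaban1983to89.B5Prop11Lower (nsq)
open Literature.MathematicalPhysics.QuantumFieldTheory.Balaban1983to89.B5Block118 (bpt iota up tstep tstep_zero tstep_succ)
open Literature.MathematicalPhysics.QuantumFieldTheory.Balaban1983to89.B5Blocks16 (bpt_bijective)
open Literature.MathematicalPhysics.QuantumFieldTheory.Balaban1983to89.B5Composition116 (sites)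
open Literature.MathematicalPhysics.QuantumFieldTheory.Balaban1983to89.T4EtaRateMin (Readings LocalRate)
open Summit.QuantumFields.BalabanUV.T4Continuum.VariationalTransfer (blockSpin)
open Summit.QuantumFields.BalabanUV.T4Continuum.VariationalCovariantFederbush (piT mis)
open Summit.QuantumFields.BalabanUV.T4Continuum.VariationalCovariantScalarPair (Sc qW Qk)
open Summit.QuantumFields.BalabanUV.T4Continuum.VariationalCovariantLipschitz (aligned phaseRatio scalar_lipschitz_abs)
open Summit.QuantumFields.BalabanUV.T4Continuum.VariationalCovariantTower (Rtr)
open Summit.QuantumFields.BalabanUV.T4Continuum.NestedContourTransport (one_add_pow_sub_linear_le)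

variable {d : ℕ} (L : ℕ) [NeZero L] (M : Fin d → ℕ) [hM : ∀ μ, NeZero (M μ)]

/-! ## §1 Block addresses on the P2 tori -/

/-- the level-`k` site with unit-lattice point `x₀` and in-block offsets `r 0, …, r (k−1)`: `pt (k+1)` is the fine site of offset `r k` in the
block of `pt k`, in level-`k+1` coordinates (`L^(k+1) = L^k·L` by `rfl`). [cite: King1986, (2.10) p.653 («B^k(y)», shape)] [folklore] -/
def pt (x₀ : Tor (fine (L ^ 0) M)) (r : ℕ → (Fin d → Fin L)) : (k : ℕ) → Tor (fine (L ^ k) M)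
  | 0 => x₀
  | k + 1 => (sites (L ^ k) L M).symm (bpt L (fine (L ^ k) M) (pt x₀ r k) (r k))

omit [NeZero L] hM in
/-- the successor address is the child of offset `r k`. [folklore] -/
theorem pt_succ (x₀ : Tor (fine (L ^ 0) M)) (r : ℕ → (Fin d → Fin L)) (k : ℕ) :
    pt L M x₀ r (k + 1) = (sites (L ^ k) L M).symm (bpt L (fine (L ^ k) M) (pt L M x₀ r k) (r k)) := rfl

omit [NeZero L] hM in
/-- addresses agreeing below `k` give the same level-`k` site. [folklore] -/
theorem pt_congr (x₀ : Tor (fine (L ^ 0) M)) {r r' : ℕ → (Fin d → Fin L)} :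
    ∀ k, (∀ j < k, r j = r' j) → pt L M x₀ r k = pt L M x₀ r' k
  | 0, _ => rfl
  | k + 1, h => by
    rw [pt_succ, pt_succ, pt_congr x₀ k fun j hj => h j (Nat.lt_succ_of_lt hj), h k (Nat.lt_succ_self k)]

/-- every site has an address. [folklore] -/
theorem exists_pt : ∀ (k : ℕ) (x : Tor (fine (L ^ k) M)), ∃ x₀ r, pt L M x₀ r k = x
  | 0, x => ⟨x, fun _ _ => 0, rfl⟩
  | k + 1, x => by
    obtain ⟨⟨y, j⟩, hyj⟩ := (bpt_bijective L (fine (L ^ k) M)).2 (sites (L ^ k) L M x)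
    obtain ⟨x₀, r, h⟩ := exists_pt k y
    refine ⟨x₀, Function.update r k j, ?_⟩
    have hk : pt L M x₀ (Function.update r k j) k = pt L M x₀ r k :=
      pt_congr L M x₀ k fun i hi => Function.update_of_ne (ne_of_lt hi) _ _
    rw [pt_succ, hk, h, Function.update_self]
    change bpt L (fine (L ^ k) M) y j = sites (L ^ k) L M x at hyj
    rw [hyj, Equiv.symm_apply_apply]

/-! ## §2 The readings of a class of connection towers -/

/-- a UNIT-SCALE ADDRESS of the readings: unit-lattice point, in-block offsets at every level, bond direction, real ∕ imaginary part. [folklore] -/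
structure Site {d : ℕ} (L : ℕ) (M : Fin d → ℕ) where
  /-- unit-lattice point -/
  base : Tor (fine (L ^ 0) M)
  /-- in-block offsets at every level -/
  addr : ℕ → (Fin d → Fin L)
  /-- bond direction -/
  dir : Fin d
  /-- real (`true`) or imaginary (`false`) part -/
  re : Bool

/-- real (`true`) or imaginary (`false`) part of a complex number. [folklore] -/
def part : Bool → ℂ → ℝ
  | true, z => z.re
  | false, z => z.im

/-- `part` of a difference. [folklore] -/
theorem part_sub (b : Bool) (z w : ℂ) : part b (z - w) = part b z - part b w := by
  cases b
  · exact Complex.sub_im z w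
  · exact Complex.sub_re z w

/-- `|part b z| ≤ ‖z‖`. [folklore] -/
theorem abs_part_le_norm (b : Bool) (z : ℂ) : |part b z| ≤ ‖z‖ := by
  cases b
  · exact Complex.abs_im_le_norm z
  · exact Complex.abs_re_le_norm z

/-- `‖z‖ ≤ |Re z| + |Im z|`. [folklore] -/
theorem norm_le_abs_part_add (z : ℂ) : ‖z‖ ≤ |part true z| + |part false z| := Complex.norm_le_abs_re_add_abs_im z

/-- the NORMALISED reading `L^k·(R k (pt x₀ r k) μ − 1)` of a tower at an address after `k` steps. [folklore] -/
def reading (R : (k : ℕ) → Tor (fine (L ^ k) M) → Fin d → ℂ) (k : ℕ) (s : Site L M) : ℂ :=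
  ((L ^ k : ℕ) : ℂ) * (R k (pt L M s.base s.addr k) s.dir - 1)

/-- **THE READINGS OF A CLASS `𝒟` OF CONNECTION TOWERS** on the P2 tori (node U1b's `T4EtaRateMin.Readings`; scalar reading and volume unused,
as in row B6's `NE2FromNE3.bgReadings`): datum = a tower `R ∈ 𝒟`, local reading after `k` steps at address `s` = `Re∕Im (L^k·(R k (pt s k) μ − 1))`.
READING (not asserted): `R k` = the bond phases of the `k`-step run's background at level `k` in a complete axial gauge. [folklore] -/
def towReadings (𝒟 : Set ((k : ℕ) → Tor (fine (L ^ k) M) → Fin d → ℂ)) :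
    Readings ((k : ℕ) → Tor (fine (L ^ k) M) → Fin d → ℂ) (Site L M) where
  dom := 𝒟
  act := fun _ _ => 0
  loc := fun k R s => part s.re (reading L M R k s)
  vol := 0
  vol_nonneg := le_rfl

/-- the same readings for a FAMILY of towers `Rt V` indexed by data `V : ι` with admissible set `dom` (the shape in which node U1b states
uniformity in the datum; READING, not asserted: `V` = a unit-lattice configuration in the small-field region, `Rt V k` = the phases of its
`k`-step run's background).  Its `loc` is the consumer-supplied local reading a carrier such as `MinimalActionRate.minActReadings … loc` expects. [folklore] -/
def famReadings {ι : Type*} (Rt : ι → ((k : ℕ) → Tor (fine (L ^ k) M) → Fin d → ℂ)) (dom : Set ι) : Readings ι (Site L M) where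
  dom := dom
  act := fun _ _ => 0
  loc := fun k V s => part s.re (reading L M (Rt V) k s)
  vol := 0
  vol_nonneg := le_rfl

omit [NeZero L] hM in
/-- family form ⇔ class form on the image class `Rt '' dom`. [folklore] -/
theorem localRate_famReadings_iff {ι : Type*} (Rt : ι → ((k : ℕ) → Tor (fine (L ^ k) M) → Fin d → ℂ)) (dom : Set ι) (C θ : ℝ) :
    LocalRate (famReadings L M Rt dom) C θ ↔ LocalRate (towReadings L M (Rt '' dom)) C θ := by
  constructor
  · rintro h k R ⟨V, hV, rfl⟩ s
    exact h k V hV s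
  · intro h k V hV s
    exact h k (Rt V) ⟨V, hV, rfl⟩ s

/-! ## §3 `LocalRate` ⇔ child-bond ∕ parent-bond consistency of the normalised tower -/

/-- **NE3's currency ⟹ two-level consistency of the normalised phases at King's corresponding bonds**: for every tower of the class,
`‖L^{k+1}·(R (k+1) (child of y at offset j) μ − 1) − L^k·(R k y μ − 1)‖ ≤ 2Cθ^k`. [folklore] -/
theorem consistent_of_localRate {𝒟 : Set ((k : ℕ) → Tor (fine (L ^ k) M) → Fin d → ℂ)} {C θ : ℝ}
    (h : LocalRate (towReadings L M 𝒟) C θ) {R : (k : ℕ) → Tor (fine (L ^ k) M) → Fin d → ℂ} (hR : R ∈ 𝒟) (k : ℕ)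
    (y : Tor (fine (L ^ k) M)) (j : Fin d → Fin L) (μ : Fin d) :
    ‖((L ^ (k + 1) : ℕ) : ℂ) * (R (k + 1) ((sites (L ^ k) L M).symm (bpt L (fine (L ^ k) M) y j)) μ - 1)
        - ((L ^ k : ℕ) : ℂ) * (R k y μ - 1)‖ ≤ 2 * (C * θ ^ k) := by
  obtain ⟨x₀, r, hx⟩ := exists_pt L M k y
  have hk : pt L M x₀ (Function.update r k j) k = y := by
    rw [← hx]; exact pt_congr L M x₀ k fun i hi => Function.update_of_ne (ne_of_lt hi) _ _
  have hk1 : pt L M x₀ (Function.update r k j) (k + 1) = (sites (L ^ k) L M).symm (bpt L (fine (L ^ k) M) y j) := by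
    rw [pt_succ, hk, Function.update_self]
  have e : ∀ b : Bool, reading L M R (k + 1) ⟨x₀, Function.update r k j, μ, b⟩ - reading L M R k ⟨x₀, Function.update r k j, μ, b⟩
      = ((L ^ (k + 1) : ℕ) : ℂ) * (R (k + 1) ((sites (L ^ k) L M).symm (bpt L (fine (L ^ k) M) y j)) μ - 1)
          - ((L ^ k : ℕ) : ℂ) * (R k y μ - 1) := by
    intro b
    show ((L ^ (k + 1) : ℕ) : ℂ) * (R (k + 1) (pt L M x₀ (Function.update r k j) (k + 1)) μ - 1)
        - ((L ^ k : ℕ) : ℂ) * (R k (pt L M x₀ (Function.update r k j) k) μ - 1) = _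
    rw [hk1, hk]
  have key : ∀ b : Bool, |part b (reading L M R (k + 1) ⟨x₀, Function.update r k j, μ, b⟩
      - reading L M R k ⟨x₀, Function.update r k j, μ, b⟩)| ≤ C * θ ^ k := by
    intro b
    rw [part_sub]
    exact h k R hR ⟨x₀, Function.update r k j, μ, b⟩
  have hre := key true
  have him := key false
  rw [e] at hre him
  calc _ ≤ |part true _| + |part false _| := norm_le_abs_part_add _
    _ ≤ C * θ ^ k + C * θ ^ k := add_le_add hre him
    _ = 2 * (C * θ ^ k) := by ring

omit [NeZero L] hM in
/-- **THE CONVERSE** (the adapter is faithful): child ∕ parent consistency `≤ Cθ^k` for every tower of the class gives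
`LocalRate (towReadings 𝒟) C θ`. [folklore] -/
theorem localRate_of_consistent {𝒟 : Set ((k : ℕ) → Tor (fine (L ^ k) M) → Fin d → ℂ)} {C θ : ℝ}
    (h : ∀ R ∈ 𝒟, ∀ (k : ℕ) (y : Tor (fine (L ^ k) M)) (j : Fin d → Fin L) (μ : Fin d),
      ‖((L ^ (k + 1) : ℕ) : ℂ) * (R (k + 1) ((sites (L ^ k) L M).symm (bpt L (fine (L ^ k) M) y j)) μ - 1)
        - ((L ^ k : ℕ) : ℂ) * (R k y μ - 1)‖ ≤ C * θ ^ k) :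
    LocalRate (towReadings L M 𝒟) C θ := by
  intro k R hR s
  show |part s.re (reading L M R (k + 1) s) - part s.re (reading L M R k s)| ≤ C * θ ^ k
  rw [← part_sub]
  exact (abs_part_le_norm _ _).trans (h R hR k (pt L M s.base s.addr k) (s.addr k) s.dir)

/-! ## §4 One level, pure algebra: the straight product of `L` phases against the coarse phase -/

section OneLevel

variable (N : Fin d → ℕ) [∀ μ, NeZero (N μ)]

omit [NeZero L] [∀ μ, NeZero (N μ)] in
/-- product telescoping: if every factor on the path is within `b` of `1`, then `‖Π_T − 1‖ ≤ (1+b)^T − 1` and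
`‖Π_T − 1 − Σ_{t<T}(R′_t − 1)‖ ≤ (1+b)^T − 1 − T·b`. [folklore] -/
theorem norm_piT_sub_one_le (R' : Tor (fine L N) → Fin d → ℂ) (x : Tor (fine L N)) (μ : Fin d) {b : ℝ} (hb : 0 ≤ b)
    (hR : ∀ t : ℕ, ‖R' (x + tstep (fine L N) μ t) μ - 1‖ ≤ b) :
    ∀ T : ℕ, ‖piT L N R' x μ T - 1‖ ≤ (1 + b) ^ T - 1 ∧
      ‖piT L N R' x μ T - 1 - ∑ t ∈ range T, (R' (x + tstep (fine L N) μ t) μ - 1)‖ ≤ (1 + b) ^ T - 1 - T * b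
  | 0 => by simp [piT]
  | T + 1 => by
    obtain ⟨h1, h2⟩ := norm_piT_sub_one_le R' x μ hb hR T
    have ha : ‖R' (x + tstep (fine L N) μ T) μ - 1‖ ≤ b := hR T
    have hP0 : 0 ≤ (1 + b) ^ T - 1 := sub_nonneg.mpr (one_le_pow₀ (by linarith))
    have hPa : piT L N R' x μ (T + 1) = piT L N R' x μ T * (1 + (R' (x + tstep (fine L N) μ T) μ - 1)) := by
      simp only [piT]; ring
    refine ⟨?_, ?_⟩
    · rw [hPa]
      have e : piT L N R' x μ T * (1 + (R' (x + tstep (fine L N) μ T) μ - 1)) - 1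
          = (piT L N R' x μ T - 1) * (1 + (R' (x + tstep (fine L N) μ T) μ - 1)) + (R' (x + tstep (fine L N) μ T) μ - 1) := by ring
      rw [e]
      have h1a : ‖1 + (R' (x + tstep (fine L N) μ T) μ - 1)‖ ≤ 1 + b :=
        (norm_add_le _ _).trans (by rw [norm_one]; exact add_le_add le_rfl ha)
      calc _ ≤ ‖piT L N R' x μ T - 1‖ * ‖1 + (R' (x + tstep (fine L N) μ T) μ - 1)‖ + ‖R' (x + tstep (fine L N) μ T) μ - 1‖ :=
            (norm_add_le _ _).trans (by rw [norm_mul])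
        _ ≤ ((1 + b) ^ T - 1) * (1 + b) + b :=
            add_le_add (mul_le_mul h1 h1a (norm_nonneg _) hP0) ha
        _ = (1 + b) ^ (T + 1) - 1 := by ring
    · rw [hPa, sum_range_succ]
      have e : piT L N R' x μ T * (1 + (R' (x + tstep (fine L N) μ T) μ - 1)) - 1
            - (∑ t ∈ range T, (R' (x + tstep (fine L N) μ t) μ - 1) + (R' (x + tstep (fine L N) μ T) μ - 1))
          = (piT L N R' x μ T - 1 - ∑ t ∈ range T, (R' (x + tstep (fine L N) μ t) μ - 1))
            + (piT L N R' x μ T - 1) * (R' (x + tstep (fine L N) μ T) μ - 1) := by ring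
      rw [e]
      calc _ ≤ ‖piT L N R' x μ T - 1 - ∑ t ∈ range T, (R' (x + tstep (fine L N) μ t) μ - 1)‖
              + ‖piT L N R' x μ T - 1‖ * ‖R' (x + tstep (fine L N) μ T) μ - 1‖ :=
            (norm_add_le _ _).trans (by rw [norm_mul])
        _ ≤ ((1 + b) ^ T - 1 - T * b) + ((1 + b) ^ T - 1) * b :=
            add_le_add h2 (mul_le_mul h1 ha (norm_nonneg _) hP0)
        _ = (1 + b) ^ (T + 1) - 1 - ((T + 1 : ℕ) : ℝ) * b := by push_cast; ring

omit [∀ μ, NeZero (N μ)] in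
/-- **THE ONE-LEVEL ESTIMATE**: per-bond size `‖R′ − 1‖ ≤ b` on the path and NORMALISED consistency `‖nL·(R′_t − 1) − n·w‖ ≤ β` for the
`L` bonds of the path give `n·‖Π_L R′ − (1 + w)‖ ≤ β + n·((Lb)²∕2·(1+b)^L)` (first order: the average of the `L` normalised fine phases IS
the normalised coarse phase up to `β`; second order: product telescoping). [folklore] -/
theorem norm_piT_sub_le (R' : Tor (fine L N) → Fin d → ℂ) (x : Tor (fine L N)) (μ : Fin d) (w : ℂ) (n : ℕ) {b β : ℝ}
    (hb : 0 ≤ b) (hsize : ∀ t : ℕ, ‖R' (x + tstep (fine L N) μ t) μ - 1‖ ≤ b)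
    (hcons : ∀ t < L, ‖((n * L : ℕ) : ℂ) * (R' (x + tstep (fine L N) μ t) μ - 1) - (n : ℂ) * w‖ ≤ β) :
    (n : ℝ) * ‖piT L N R' x μ L - (1 + w)‖ ≤ β + n * ((L * b) ^ 2 / 2 * (1 + b) ^ L) := by
  have hL : (L : ℂ) ≠ 0 := Nat.cast_ne_zero.mpr (NeZero.ne L)
  have hLpos : (0 : ℝ) < L := Nat.cast_pos.mpr (Nat.pos_of_ne_zero (NeZero.ne L))
  obtain ⟨-, h2⟩ := norm_piT_sub_one_le L N R' x μ hb hsize L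
  -- first order: `n·(Σ_t (R′_t − 1) − w) = L⁻¹·Σ_t (nL·(R′_t − 1) − n·w)`
  have hS : ∑ t ∈ range L, (((n * L : ℕ) : ℂ) * (R' (x + tstep (fine L N) μ t) μ - 1) - (n : ℂ) * w)
      = ((n * L : ℕ) : ℂ) * ∑ t ∈ range L, (R' (x + tstep (fine L N) μ t) μ - 1) - (L : ℂ) * ((n : ℂ) * w) := by
    rw [sum_sub_distrib, ← mul_sum, sum_const, card_range, nsmul_eq_mul]
  have e1 : (n : ℂ) * (∑ t ∈ range L, (R' (x + tstep (fine L N) μ t) μ - 1) - w)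
      = (L : ℂ)⁻¹ * ∑ t ∈ range L, (((n * L : ℕ) : ℂ) * (R' (x + tstep (fine L N) μ t) μ - 1) - (n : ℂ) * w) := by
    rw [hS]
    push_cast
    field_simp
  have h1 : ‖(n : ℂ) * (∑ t ∈ range L, (R' (x + tstep (fine L N) μ t) μ - 1) - w)‖ ≤ β := by
    rw [e1, norm_mul, norm_inv, Complex.norm_natCast]
    calc (L : ℝ)⁻¹ * ‖∑ t ∈ range L, (((n * L : ℕ) : ℂ) * (R' (x + tstep (fine L N) μ t) μ - 1) - (n : ℂ) * w)‖
        ≤ (L : ℝ)⁻¹ * ∑ t ∈ range L, β := by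
          gcongr
          exact (norm_sum_le _ _).trans (sum_le_sum fun t ht => hcons t (mem_range.mp ht))
      _ = β := by rw [sum_const, card_range, nsmul_eq_mul]; field_simp
  have e2 : piT L N R' x μ L - (1 + w)
      = (piT L N R' x μ L - 1 - ∑ t ∈ range L, (R' (x + tstep (fine L N) μ t) μ - 1))
        + (∑ t ∈ range L, (R' (x + tstep (fine L N) μ t) μ - 1) - w) := by ring
  have h3 := one_add_pow_sub_linear_le hb L
  calc (n : ℝ) * ‖piT L N R' x μ L - (1 + w)‖
      ≤ (n : ℝ) * (‖piT L N R' x μ L - 1 - ∑ t ∈ range L, (R' (x + tstep (fine L N) μ t) μ - 1)‖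
          + ‖∑ t ∈ range L, (R' (x + tstep (fine L N) μ t) μ - 1) - w‖) := by
        rw [e2]; exact mul_le_mul_of_nonneg_left (norm_add_le _ _) (Nat.cast_nonneg n)
    _ = (n : ℝ) * ‖piT L N R' x μ L - 1 - ∑ t ∈ range L, (R' (x + tstep (fine L N) μ t) μ - 1)‖
          + ‖(n : ℂ) * (∑ t ∈ range L, (R' (x + tstep (fine L N) μ t) μ - 1) - w)‖ := by
        rw [mul_add, norm_mul, Complex.norm_natCast]
    _ ≤ (n : ℝ) * ((L * b) ^ 2 / 2 * (1 + b) ^ L) + β :=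
        add_le_add (mul_le_mul_of_nonneg_left (h2.trans h3) (Nat.cast_nonneg n)) h1
    _ = β + n * ((L * b) ^ 2 / 2 * (1 + b) ^ L) := by ring

omit [NeZero L] [∀ μ, NeZero (N μ)] in
/-- splitting the one-block transport mismatch at an intermediate coarse connection `R̄` (`‖T′‖ ≤ 1`):
`‖mis Rc R′ T′ (y,μ,j)‖ ≤ ‖Rc(y,μ) − R̄(y,μ)‖ + ‖mis R̄ R′ T′ (y,μ,j)‖`. [folklore] -/
theorem norm_mis_le (Rc Rb : Tor N → Fin d → ℂ) (R' : Tor (fine L N) → Fin d → ℂ) {T' : Tor (fine L N) → ℂ}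
    (hT' : ∀ x, ‖T' x‖ ≤ 1) (y : Tor N) (μ : Fin d) (j : Fin d → Fin L) :
    ‖mis L N Rc R' T' y μ j‖ ≤ ‖Rc y μ - Rb y μ‖ + ‖mis L N Rb R' T' y μ j‖ := by
  have e : mis L N Rc R' T' y μ j = (Rc y μ - Rb y μ) * T' (bpt L N (y + unitVec N μ) j) + mis L N Rb R' T' y μ j := by
    unfold mis; ring
  rw [e]
  calc _ ≤ ‖(Rc y μ - Rb y μ) * T' (bpt L N (y + unitVec N μ) j)‖ + ‖mis L N Rb R' T' y μ j‖ := norm_add_le _ _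
    _ ≤ ‖Rc y μ - Rb y μ‖ * 1 + ‖mis L N Rb R' T' y μ j‖ := by
        rw [norm_mul]
        exact add_le_add (mul_le_mul_of_nonneg_left (hT' _) (norm_nonneg (Rc y μ - Rb y μ))) le_rfl
    _ = _ := by rw [mul_one]

omit [∀ μ, NeZero (N μ)] in
/-- for EQUAL unit-modulus site transports the aligned connection is the connection itself. [folklore] -/
theorem aligned_phaseRatio_self {T : Tor N → ℂ} (hT : ∀ x, ‖T x‖ = 1) (R' : Tor N → Fin d → ℂ) :
    aligned N (phaseRatio N T T) R' = R' := by
  have hu : ∀ x, phaseRatio N T T x = 1 := fun x => by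
    show (starRingEnd ℂ) (T x) * T x = 1
    rw [Complex.conj_mul', hT x]; simp
  funext y μ
  simp [aligned, hu]

/-- the in-block offset `t·e_μ` (`0 ≤ t < L`). [folklore] -/
def axisOff (μ : Fin d) (t : Fin L) : Fin d → Fin L := fun ν => if ν = μ then t else 0

omit [∀ μ, NeZero (N μ)] in
/-- the `t`-th fine site on the coarse bond `(y, μ)` from the block base point is the block point of offset `t·e_μ`. [folklore] -/
theorem bpt_zero_add_tstep (y : Tor N) (μ : Fin d) (t : Fin L) :
    bpt L N y 0 + tstep (fine L N) μ t = bpt L N y (axisOff L μ t) := by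
  funext ν
  simp only [bpt, iota, axisOff, Pi.add_apply, tstep]
  by_cases hν : ν = μ
  · subst hν; simp
  · simp [hν]

/-- THE STRAIGHT-PRODUCT COARSENING of a fine connection: the product of its `L` phases along the coarse bond `(y, μ)` from the block base point
`Ly` to the next base point `L(y + e_μ)` (the `j = 0`, `T′ = 1` reading of `VariationalCovariantFederbush.mis`). [folklore] -/
def coarsen (R' : Tor (fine L N) → Fin d → ℂ) (y : Tor N) (μ : Fin d) : ℂ := piT L N R' (bpt L N y 0) μ L

end OneLevel

end Summit.QuantumFields.BalabanUV.T4Continuum.VariationalCovariantTwoRuns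

end
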